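import Mathlib.MeasureTheory.Measure.Tilted
import Literature.Probability.Moments.VarianceBookkeeping
import HarnessLib

/-!
# Holley–Stroock in Lipschitz form: a tilt of oscillation `≤ δ` multiplies variances by at most `e^δ`

HONEST FRAMING.  An abstract measure-theoretic lemma (any probability space), written for the cell `pub-ymgap` (venture `YMGap`),
track Y2 ROBUST-BALL, seat engine-2 (g5), as the transfer step of the robust one-link lemma (`Thresholds/OneLinkHolleyStroock.lean`).
No lattice, no gauge group, no number of any ledger; NOT a Yang–Mills claim of any kind.

THE LEMMA (R. Holley, D. Stroock, J. Stat. Phys. 46 (1987) 1159–1194, bounded-perturbation lemma, in the form needed for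
LIPSCHITZ-type Poincaré inequalities `Var ≤ c·Lip²`; folklore).  Let `μ` be a probability measure and `U` a bounded measurable tilt
whose OSCILLATION is at most `δ`: `U s ≤ U s' + δ` for all `s, s'`.  Then the tilted probability measure
`μ^U := e^U μ / μ(e^U)` (Mathlib's `μ.tilted U`) has density `e^{U(s)}/μ(e^U) ≤ e^δ` (`exp_div_integral_exp_le`), hence for every
bounded measurable `X`
  `Var_{μ^U}(X) ≤ ∫ (X − μ(X))² dμ^U ≤ e^δ ∫ (X − μ(X))² dμ = e^δ · Var_μ(X)`   (`variance_tilted_le_exp_mul`)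
— ONE factor `e^δ` (the Dirichlet-form version of Holley–Stroock pays `e^{2δ}`; a Lipschitz-form right-hand side `c·Lip²` is a
constant and pays nothing on the right).  Also recorded: convex interpolation `U' + t(U − U')`, `t ∈ [0,1]`, of two tilts of
oscillation `≤ δ` has oscillation `≤ δ` (`osc_interpolate_le`), used for the cross direction of the one-link lemma.
-/

noncomputable section

open MeasureTheory ProbabilityTheory Real

namespace Summit.Ventures.YMGap.TiltOscillationVariance

section Abstract

variable {S : Type*} [MeasurableSpace S] {μ : Measure S}

/-- Bounded measurable real functions are integrable against a finite measure. [folklore] -/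
theorem integrable_of_abs_le [IsFiniteMeasure μ] {f : S → ℝ} (hf : Measurable f) {C : ℝ} (hC : ∀ s, |f s| ≤ C) :
    Integrable f μ :=
  Integrable.of_bound hf.aestronglyMeasurable C (ae_of_all _ fun s => by rw [Real.norm_eq_abs]; exact hC s)

/-- A bounded measurable tilt has an integrable exponential (against a finite measure). [folklore] -/
theorem integrable_exp_of_abs_le [IsFiniteMeasure μ] {U : S → ℝ} (hUm : Measurable U)
    (hUb : ∃ C, ∀ s, |U s| ≤ C) : Integrable (fun x => exp (U x)) μ := by
  obtain ⟨C, hC⟩ := hUb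
  exact integrable_of_abs_le hUm.exp (C := exp C) fun x => by
    rw [abs_of_nonneg (exp_pos _).le]; exact exp_le_exp.2 ((le_abs_self _).trans (hC x))

/-- **The density of a tilt of oscillation `≤ δ` is at most `e^δ`**: if `U s ≤ U s' + δ` for all `s, s'`, then
`e^{U(s)} / ∫ e^U dμ ≤ e^δ` for a probability measure `μ`. [folklore] -/
theorem exp_div_integral_exp_le [IsProbabilityMeasure μ] {U : S → ℝ} {δ : ℝ} (hUm : Measurable U)
    (hUb : ∃ C, ∀ s, |U s| ≤ C) (hosc : ∀ s s', U s ≤ U s' + δ) (s : S) :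
    exp (U s) / ∫ x, exp (U x) ∂μ ≤ exp δ := by
  have hint : Integrable (fun x => exp (U x)) μ := integrable_exp_of_abs_le hUm hUb
  have hZ : exp (U s - δ) ≤ ∫ x, exp (U x) ∂μ := by
    have h1 : ∫ _x, exp (U s - δ) ∂μ = exp (U s - δ) := by simp
    rw [← h1]
    exact integral_mono (integrable_const _) hint fun x => exp_le_exp.2 (by linarith [hosc s x])
  have hZpos : 0 < ∫ x, exp (U x) ∂μ := lt_of_lt_of_le (exp_pos _) hZ
  rw [div_le_iff₀ hZpos]
  calc exp (U s) = exp δ * exp (U s - δ) := by rw [← exp_add]; ring_nf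
    _ ≤ exp δ * ∫ x, exp (U x) ∂μ := mul_le_mul_of_nonneg_left hZ (exp_pos _).le

/-- **Second moments about a constant grow by at most `e^δ` under a tilt of oscillation `≤ δ`**:
`∫ (X − m)² d(μ^U) ≤ e^δ ∫ (X − m)² dμ` for bounded measurable `X`. [folklore] -/
theorem integral_sub_sq_tilted_le [IsProbabilityMeasure μ] {U : S → ℝ} {δ : ℝ} (hUm : Measurable U)
    (hUb : ∃ C, ∀ s, |U s| ≤ C) (hosc : ∀ s s', U s ≤ U s' + δ) {X : S → ℝ} (hXm : Measurable X)
    (hXb : ∃ C, ∀ s, |X s| ≤ C) (m : ℝ) :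
    ∫ s, (X s - m) ^ 2 ∂μ.tilted U ≤ exp δ * ∫ s, (X s - m) ^ 2 ∂μ := by
  rw [integral_tilted, ← integral_const_mul]
  obtain ⟨C, hC⟩ := hXb
  have hsq : Integrable (fun s => (X s - m) ^ 2) μ :=
    integrable_of_abs_le ((hXm.sub_const m).pow_const 2) (C := (C + |m|) ^ 2) fun s => by
      rw [abs_of_nonneg (sq_nonneg _), ← sq_abs]
      have h1 : |X s - m| ≤ C + |m| := by
        calc |X s - m| ≤ |X s| + |m| := by
              have := abs_add_le (X s) (-m); rwa [abs_neg, ← sub_eq_add_neg] at this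
          _ ≤ C + |m| := add_le_add (hC s) le_rfl
      exact pow_le_pow_left₀ (abs_nonneg _) h1 2
  refine integral_mono_of_nonneg (ae_of_all _ fun s => ?_) (hsq.const_mul _) (ae_of_all _ fun s => ?_)
  · exact smul_nonneg (div_nonneg (exp_pos _).le (integral_nonneg fun _ => (exp_pos _).le)) (sq_nonneg _)
  · simp only [smul_eq_mul]
    exact mul_le_mul_of_nonneg_right (exp_div_integral_exp_le hUm hUb hosc s) (sq_nonneg _)

/-- **Holley–Stroock in Lipschitz form.**  For a probability measure `μ`, a bounded measurable tilt `U` of oscillation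
`≤ δ` (`U s ≤ U s' + δ`) and a bounded measurable `X`: `Var_{μ^U}(X) ≤ e^δ Var_μ(X)`, `μ^U = e^U μ / μ(e^U)` — centring
at the `μ`-mean can only increase the tilted variance, and the tilted density is `≤ e^δ`.  ONE factor `e^δ`.
[folklore] -/
theorem variance_tilted_le_exp_mul [IsProbabilityMeasure μ] {U : S → ℝ} {δ : ℝ} (hUm : Measurable U)
    (hUb : ∃ C, ∀ s, |U s| ≤ C) (hosc : ∀ s s', U s ≤ U s' + δ) {X : S → ℝ} (hXm : Measurable X)
    (hXb : ∃ C, ∀ s, |X s| ≤ C) :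
    Var[X; μ.tilted U] ≤ exp δ * Var[X; μ] := by
  haveI : IsProbabilityMeasure (μ.tilted U) := isProbabilityMeasure_tilted (integrable_exp_of_abs_le hUm hUb)
  calc Var[X; μ.tilted U] ≤ ∫ s, (X s - ∫ s', X s' ∂μ) ^ 2 ∂μ.tilted U :=
        Literature.Probability.Moments.variance_le_integral_sub_const_sq hXm.aestronglyMeasurable _
    _ ≤ exp δ * ∫ s, (X s - ∫ s', X s' ∂μ) ^ 2 ∂μ := integral_sub_sq_tilted_le hUm hUb hosc hXm hXb _
    _ = exp δ * Var[X; μ] := by rw [variance_eq_integral hXm.aemeasurable]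

end Abstract

section Interpolation

variable {S : Type*}

/-- The oscillation hypothesis from a two-sided window: `lo ≤ U ≤ hi` gives oscillation `≤ hi − lo`. [folklore] -/
theorem osc_of_mem_window {U : S → ℝ} {lo hi : ℝ} (hlo : ∀ s, lo ≤ U s) (hhi : ∀ s, U s ≤ hi) (s s' : S) :
    U s ≤ U s' + (hi - lo) := by
  linarith [hhi s, hlo s']

/-- Convex interpolation keeps the oscillation: if `U` and `U'` have oscillation `≤ δ` then so has
`U' + t (U − U')` for `t ∈ [0,1]`. [folklore] -/
theorem osc_interpolate_le {U U' : S → ℝ} {δ : ℝ} (hosc : ∀ s s', U s ≤ U s' + δ)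
    (hosc' : ∀ s s', U' s ≤ U' s' + δ) {t : ℝ} (ht : t ∈ Set.Icc (0 : ℝ) 1) (s s' : S) :
    U' s + t * (U s - U' s) ≤ U' s' + t * (U s' - U' s') + δ := by
  have h1 := hosc s s'
  have h2 := hosc' s s'
  nlinarith [ht.1, ht.2]

end Interpolation

end Summit.Ventures.YMGap.TiltOscillationVariance

end
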